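import Summits.ValiantsHypothesis.ValiantsHypothesis.Theorems.BarrierLeverIntegerBoxVanishingTransfer

/-!
# Route BarrierLever — item `SuccinctHittingSetsIffIntegerSlice` (stmt-ValiantsHypothesis-20029),
# part 3/3: FSV Question 6 is equivalent to its relative form on the integer slice of cubic
# bit-length

Continuation of `…IntegerBoxVanishingTransferSeedGrid.lean` / `…IntegerBoxVanishingTransfer.lean`.

* §4e `base_le_two_pow`, `bnd_le_two_pow_cube` — the quadratic-bit-length box fits in `2^(n³)` once
  `n ≥ 2(b + 2a + 11) + 1`; `exists_mem_intBox_eval_ne_zero` — largeness on the integer slice (a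
  nonzero level-`a` distinguisher, `2a ≤ n`, is nonzero at some polynomial with integer coefficients
  `≤ 2^(n³)`: grid interpolation again); `item_iff` — `SuccinctHittingSetsForVP ℂ ↔
  SuccinctHittingSetsForVPRel ℂ (fun n => intBox n (2 ^ (n ^ 3)))`;
* **`succinctHittingSetsIffIntegerSlice`** = the signature of item stmt-ValiantsHypothesis-20029
  VERBATIM (the slice written as a set-builder).

Reading: FSV Question 6 over `ℂ` ⟺ Question 6 on INTEGER circuits of bit-length `n³` — the whole of
Question 6 lives on a bounded-coefficient slice, to be set against CKRST 2020 (relative natural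
proofs exist on every slice of LINEAR bit-length `≤ c·n`).

Lean text authored by the cell planner seat `valiant-natproofs-p2` (gen 6, HOME/IntSlice-p2g6.lean,
rc 0), ported by the prover seat.

WHAT THIS IS NOT: not a decision of Question 6 / crux stmt-14610; nothing about `VP` vs `VNP`;
CKRST 2020 is cited context, not formalised here.

References: [ForbesShpilkaVolk2018] Lemmas 13–14, Question 6; Chatterjee–Kumar–Ramya–Saptharishi–
Tengse 2020 (arXiv:2004.14147) Thm 1.1 (context).
-/

-- layout Summits/ValiantsHypothesis/ValiantsHypothesis forces the duplicated namespace component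
set_option linter.dupNamespace false

noncomputable section

namespace Summit.ValiantsHypothesis.ValiantsHypothesis.Theorems.BarrierLever.IntSlice

open Literature.Barriers.ValiantsHypothesis Literature.Computability.AlgebraicComplexity MvPolynomial
open Summit.ValiantsHypothesis.ValiantsHypothesis.Theorems.BarrierLever.SuccinctHittingSetsForVP
open Summit.ValiantsHypothesis.ValiantsHypothesis.Theorems.BarrierLever.SuccinctHittingSetsForVP.JointGen

/-! ### §4e The cubic bit-length packaging and the RELATIVE form of Question 6 on the integer slice -/

/-- `(n + n·wd n b) · N^a (n+1) ≤ 2^((b + 2a + 11) n)` for `n ≥ 1`. -/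
theorem base_le_two_pow {n a b : ℕ} (hn : 1 ≤ n) :
    (n + n * wd n b) * ((Nat.choose (2 * n) n) ^ a * (n + 1)) ≤ 2 ^ ((b + 2 * a + 11) * n) := by
  have h2 : n ≤ 2 ^ n := Nat.lt_two_pow_self.le
  have h3 : n + 1 ≤ 2 ^ n := Nat.lt_two_pow_self
  have hb : n ^ b ≤ 2 ^ (b * n) := by rw [pow_mul']; exact Nat.pow_le_pow_left h2 b
  have hNa : (Nat.choose (2 * n) n) ^ a ≤ 2 ^ (2 * n * a) := by
    rw [pow_mul]; exact Nat.pow_le_pow_left (Nat.choose_le_two_pow _ _) a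
  have hs : n ^ b + n + 2 ≤ 2 ^ (b * n + n + 2) := by
    have h4 : n + 2 ≤ 2 ^ (n + 1) := by rw [pow_succ]; omega
    have hA : 1 ≤ 2 ^ (b * n) := Nat.one_le_two_pow
    have hB : 1 ≤ 2 ^ (n + 1) := Nat.one_le_two_pow
    calc n ^ b + n + 2 ≤ 2 ^ (b * n) + 2 ^ (n + 1) := by omega
      _ ≤ 2 * (2 ^ (b * n) * 2 ^ (n + 1)) := by nlinarith
      _ = 2 ^ (b * n + n + 2) := by ring
  have hwd : wd n b ≤ 2 ^ (b * n + 4 * n + 4) := by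
    show 4 * ((n + 1) * (n ^ b + n + 2)) * (n + 1) ^ 2 ≤ _
    calc 4 * ((n + 1) * (n ^ b + n + 2)) * (n + 1) ^ 2
        ≤ 4 * (2 ^ n * 2 ^ (b * n + n + 2)) * (2 ^ n) ^ 2 := by gcongr
      _ = 2 ^ (b * n + 4 * n + 4) := by ring
  have hL : n + n * wd n b ≤ 2 ^ (b * n + 5 * n + 5) := by
    calc n + n * wd n b ≤ 2 ^ n + 2 ^ n * 2 ^ (b * n + 4 * n + 4) := by gcongr
      _ ≤ 2 ^ (b * n + 5 * n + 5) := by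
          have : 2 ^ n ≤ 2 ^ n * 2 ^ (b * n + 4 * n + 4) :=
            Nat.le_mul_of_pos_right _ Nat.one_le_two_pow
          calc 2 ^ n + 2 ^ n * 2 ^ (b * n + 4 * n + 4) ≤ 2 * (2 ^ n * 2 ^ (b * n + 4 * n + 4)) := by omega
            _ = 2 ^ (b * n + 5 * n + 5) := by ring
  have hH : (Nat.choose (2 * n) n) ^ a * (n + 1) ≤ 2 ^ (2 * n * a + n) := by
    calc (Nat.choose (2 * n) n) ^ a * (n + 1) ≤ 2 ^ (2 * n * a) * 2 ^ n := Nat.mul_le_mul hNa h3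
      _ = 2 ^ (2 * n * a + n) := by ring
  calc (n + n * wd n b) * ((Nat.choose (2 * n) n) ^ a * (n + 1))
      ≤ 2 ^ (b * n + 5 * n + 5) * 2 ^ (2 * n * a + n) := Nat.mul_le_mul hL hH
    _ = 2 ^ ((b + 2 * a + 6) * n + 5) := by ring
    _ ≤ 2 ^ ((b + 2 * a + 11) * n) := Nat.pow_le_pow_right (by norm_num) (by nlinarith)

/-- **Cubic bit-length suffices**: `bnd n b (N^a (n+1)) ≤ 2^(n³)` for `n ≥ 2(b + 2a + 11) + 1`. -/
theorem bnd_le_two_pow_cube {n a b : ℕ} (hn : 2 * (b + 2 * a + 11) + 1 ≤ n) :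
    bnd n b ((Nat.choose (2 * n) n) ^ a * (n + 1)) ≤ 2 ^ (n ^ 3) := by
  have hn1 : 1 ≤ n := by omega
  unfold bnd
  calc ((n + n * wd n b) * ((Nat.choose (2 * n) n) ^ a * (n + 1))) ^ (2 * n + 1)
      ≤ (2 ^ ((b + 2 * a + 11) * n)) ^ (2 * n + 1) := Nat.pow_le_pow_left (base_le_two_pow hn1) _
    _ = 2 ^ ((b + 2 * a + 11) * n * (2 * n + 1)) := by rw [← pow_mul]
    _ ≤ 2 ^ (n ^ 3) := Nat.pow_le_pow_right (by norm_num) (by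
        have h1 : (b + 2 * a + 11) * (2 * n + 1) ≤ n * n := by nlinarith
        calc (b + 2 * a + 11) * n * (2 * n + 1) = ((b + 2 * a + 11) * (2 * n + 1)) * n := by ring
          _ ≤ (n * n) * n := Nat.mul_le_mul_right _ h1
          _ = n ^ 3 := by ring)

/-- **Largeness on the integer slice**: a nonzero level-`a` distinguisher (`2a ≤ n`) is nonzero at
some polynomial with integer coefficients of absolute value `≤ 2^(n³)` (grid interpolation again). -/
theorem exists_mem_intBox_eval_ne_zero {n a : ℕ} (hn : 2 * a ≤ n)
    {D : MvPolynomial (degLEMonomials n) ℂ} (hD : D ∈ Distinguishers ℂ n a) (hD0 : D ≠ 0) :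
    ∃ g ∈ intBox n (2 ^ (n ^ 3)), eval (coeffVector (degLEMonomials n) g) D ≠ 0 := by
  classical
  haveI : Fintype (degLEMonomials n) := (Finsupp.finite_of_degree_le (σ := Fin n) n).fintype
  by_contra hcon
  push Not at hcon
  apply hD0
  refine eq_zero_of_eval_int_grid D (2 ^ (n ^ 3)) ?_ (fun x hx => ?_)
  · have h2a : 2 * n * a ≤ n ^ 3 := by
      calc 2 * n * a = n * (2 * a) := by ring
        _ ≤ n * (n * n) := Nat.mul_le_mul_left _ (hn.trans (Nat.le_mul_self n))
        _ = n ^ 3 := by ring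
    calc D.totalDegree ≤ (Nat.choose (2 * n) n) ^ a := hD.2
      _ ≤ (2 ^ (2 * n)) ^ a := Nat.pow_le_pow_left (Nat.choose_le_two_pow _ _) _
      _ = 2 ^ (2 * n * a) := by rw [← pow_mul]
      _ ≤ 2 ^ (n ^ 3) := Nat.pow_le_pow_right (by norm_num) h2a
      _ ≤ 2 * 2 ^ (n ^ 3) := by omega
  · let g : MvPolynomial (Fin n) ℂ := ∑ m : degLEMonomials n, monomial (m : Fin n →₀ ℕ) ((x m : ℤ) : ℂ)
    have hcoeff : ∀ μ : Fin n →₀ ℕ, coeff μ g =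
        if hμ : μ.degree ≤ n then ((x ⟨μ, hμ⟩ : ℤ) : ℂ) else 0 := by
      intro μ
      simp only [g, coeff_sum, coeff_monomial]
      split_ifs with hμ
      · rw [Finset.sum_eq_single ⟨μ, hμ⟩]
        · simp
        · intro m _ hm
          rw [if_neg]
          intro h
          exact hm (Subtype.ext h)
        · intro h; exact absurd (Finset.mem_univ _) h
      · refine Finset.sum_eq_zero fun m _ => ?_
        rw [if_neg]
        intro h
        exact hμ (h ▸ m.2)
    have hcv : coeffVector (degLEMonomials n) g = fun m => ((x m : ℤ) : ℂ) := by
      funext m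
      rw [coeffVector_apply, hcoeff, dif_pos (show ((m : Fin n →₀ ℕ)).degree ≤ n from m.2)]
    have hg : g ∈ intBox n (2 ^ (n ^ 3)) := by
      intro μ
      rw [hcoeff μ]
      split_ifs with hμ
      · exact ⟨x ⟨μ, hμ⟩, rfl, hx _⟩
      · exact ⟨0, by simp, by positivity⟩
    have h0 := hcon g hg
    rwa [hcv] at h0

/-- **THE ITEM — Question 6 lives on the integer slice of cubic bit-length.** FSV Question 6 over `ℂ`
holds iff it holds RELATIVE to the slice of polynomials whose coefficients are integers of absolute
value `≤ 2^(n³)` (the tree's `SuccinctHittingSetsForVPRel`, whose `P = signCoeffSlice` instance —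
bit-length `1`, and by the CKRST remark every bit-length `≤ c·n` — is refuted in print by
Chatterjee–Kumar–Ramya–Saptharishi–Tengse 2020, Thm 1.1). -/
theorem item_iff :
    SuccinctHittingSetsForVP ℂ ↔ SuccinctHittingSetsForVPRel ℂ (fun n => intBox n (2 ^ (n ^ 3))) := by
  constructor
  · intro hQ a
    obtain ⟨b, n₀, hhit⟩ := hQ a
    refine ⟨5 * b + 23, max n₀ (max (21876 * 2 ^ (5 * b + 21) + 1) (2 * (b + 2 * a + 11) + 1)),
      fun n hn D hD hex => ?_⟩
    have hn₀ : n₀ ≤ n := le_trans (le_max_left _ _) hn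
    have hnJ : 21876 * 2 ^ (5 * b + 21) + 1 ≤ n :=
      le_trans (le_trans (le_max_left _ _) (le_max_right _ _)) hn
    have hnC : 2 * (b + 2 * a + 11) + 1 ≤ n :=
      le_trans (le_trans (le_max_right _ _) (le_max_right _ _)) hn
    obtain ⟨g, -, hgne⟩ := hex
    have hD0 : D ≠ 0 := by rintro rfl; simp at hgne
    by_contra hcon
    push Not at hcon
    have hvan := vanishes_of_vanishes_on_intBox hnJ hD (fun f hf hfP =>
      hcon f hf (intBox_mono (bnd_le_two_pow_cube hnC) hfP))
    obtain ⟨f, hf, hne⟩ := hhit n hn₀ D hD hD0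
    exact hne (hvan f hf)
  · intro hR a
    obtain ⟨b, n₀, hrel⟩ := hR a
    refine ⟨b, max n₀ (2 * a), fun n hn D hD hD0 => ?_⟩
    obtain ⟨g, hg, hgne⟩ :=
      exists_mem_intBox_eval_ne_zero (le_trans (le_max_right _ _) hn) hD hD0
    obtain ⟨f, hf, -, hne⟩ := hrel n (le_trans (le_max_left _ _) hn) D hD ⟨g, hg, hgne⟩
    exact ⟨f, hf, hne⟩

/-! ### The ledger item -/

/-- **Item `SuccinctHittingSetsIffIntegerSlice` (stmt-ValiantsHypothesis-20029), signature verbatim —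
Question 6 lives on the integer slice of cubic bit-length.** FSV Question 6 over `ℂ` holds iff it
holds RELATIVE to the slice of polynomials whose coefficients are integers of absolute value
`≤ 2^(n³)`. Proof: `item_iff` (the slice is `intBox n (2 ^ (n ^ 3))` after `push_cast`). -/
theorem succinctHittingSetsIffIntegerSlice :
    Literature.Barriers.ValiantsHypothesis.SuccinctHittingSetsForVP ℂ ↔
      Literature.Barriers.ValiantsHypothesis.SuccinctHittingSetsForVPRel ℂ
        (fun n => {f : MvPolynomial (Fin n) ℂ |
          ∀ m : Fin n →₀ ℕ, ∃ z : ℤ, MvPolynomial.coeff m f = (z : ℂ) ∧ |z| ≤ 2 ^ n ^ 3}) := by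
  have h := item_iff
  have hset : (fun n => intBox n (2 ^ (n ^ 3))) = (fun n => {f : MvPolynomial (Fin n) ℂ |
        ∀ m : Fin n →₀ ℕ, ∃ z : ℤ, MvPolynomial.coeff m f = (z : ℂ) ∧ |z| ≤ 2 ^ n ^ 3}) := by
    funext n
    ext f
    simp only [intBox, Set.mem_setOf_eq]
    push_cast
    rfl
  rw [hset] at h
  exact h

end Summit.ValiantsHypothesis.ValiantsHypothesis.Theorems.BarrierLever.IntSlice

end
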